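import Summits.AtomisticToContinuum.HydrodynamicLimit.Theorems.JParityClosureLocalSecondLawEquilibriumDefs
import Summits.AtomisticToContinuum.HydrodynamicLimit.Theorems.JParityClosureLocalSecondLawInitialLayer

/-!
# Equilibrium stub E8b `eq_modulus`: continuity of the static integrand at the constant state

Registered stub of the equilibrium side-composition of line `exact-entropy-ledger-three-passivities` for the crux
`JParityClosure.LocalSecondLaw` (stmt-AtomisticToContinuum-13081, lead c2).  The static `L¹` integrand
`Ystat σ Θ ū r w x = |HsT − H̄| + ∑ₖ |HsT·(m_k/ρ_r) − H̄ ūₖ|` (`H̄ = Hs σ 1 Θ`) is a FIXED function `G` of the three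
cone fields `(ρ_r, m_r, e_r)(w, x)` — through `θ_r = (2/3)(e_r/ρ_r − |m_r|²/2ρ_r²)`, the density cutoff `cutRho` and
the guarded entropy `Hs` — evaluated minus its value at the constant state `p₀ = (1, ū, ‖ū‖²/2 + 3Θ/2)`; `G` is
continuous at `p₀` because `ρ = 1 ≠ 0`, `θ(p₀) = Θ > 0` (`initL_theta_datum`), `cutRho` is continuous, and
`(ρ, m, e) ↦ Hs σ ρ θ(ρ,m,e)` is continuous on the regular region (`initL_continuousOn_Hs`, EOS band `σ³ < η₀`).
Hence closeness of the fields within `ι` forces `Ystat < ε`.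
-/

noncomputable section

namespace Summit.AtomisticToContinuum.HydrodynamicLimit.Theorems.LocalSecondLawEquilibrium

open scoped BigOperators Topology Classical MeasureTheory ENNReal InnerProductSpace
open Filter Set MeasureTheory
open Literature.MathematicalPhysics.KineticTheory
open Literature.Analysis.FluidPDE
open Summit.AtomisticToContinuum.HydrodynamicLimit.Theorems.LocalSecondLawNegative
open Summit.AtomisticToContinuum.HydrodynamicLimit.Theorems.LocalSecondLawLedger

variable {N : ℕ}

/-- The state map of the cut entropy density: `G(ρ, m, e) = Hs σ ρ θ(ρ,m,e) · cutRho ρ`. -/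
def Gcut (σ : ℝ) (p : ℝ × V3 × ℝ) : ℝ :=
  Hs σ p.1 (2 / 3 * (p.2.2 / p.1 - ‖p.2.1‖ ^ 2 / (2 * p.1 ^ 2))) * cutRho p.1

/-- The state map of the `k`-th cut entropy-flux coefficient: `G_k(ρ, m, e) = G(ρ,m,e) · m_k/ρ`. -/
def GcutFlux (σ : ℝ) (k : Fin 3) (p : ℝ × V3 × ℝ) : ℝ :=
  Gcut σ p * (p.2.1 k / p.1)

/-- The cut entropy density of a configuration is the state map read at the cone fields. -/
theorem HsT_eq_Gcut (σ r : ℝ) (w : Phase N) (x : T3) :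
    HsT σ r w x = Gcut σ (rhoC r w x, momC r w x, kinC r w x) := by
  simp only [HsT, Gcut, thetaC]

/-- At the constant state the state map is `H̄ = Hs σ 1 Θ`. -/
theorem Gcut_const (σ Θ : ℝ) (ū : V3) : Gcut σ (1, ū, totalEnergyDensity 1 ū Θ) = Hs σ 1 Θ := by
  have h := initL_theta_datum (a := (1 : ℝ)) (t := Θ) one_pos ū
  simp only [Gcut]
  rw [one_smul] at h
  rw [h, cutRho_eq_one (by norm_num : (1 : ℝ) ≤ 2), mul_one]

/-- At the constant state the flux state map is `H̄ ūₖ`. -/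
theorem GcutFlux_const (σ Θ : ℝ) (ū : V3) (k : Fin 3) :
    GcutFlux σ k (1, ū, totalEnergyDensity 1 ū Θ) = Hs σ 1 Θ * ū k := by
  simp only [GcutFlux, Gcut_const, div_one]

/-- The state map is continuous at the constant state (EOS band `σ³ < η₀`, `Θ > 0`). -/
theorem continuousAt_Gcut {η₀ σ Θ : ℝ} {F : ℝ → ℝ} (hB : EosBand η₀ F) (hσ : 0 < σ) (hσ3 : σ ^ 3 < η₀)
    (hΘ : 0 < Θ) (ū : V3) : ContinuousAt (Gcut σ) (1, ū, totalEnergyDensity 1 ū Θ) := by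
  set p₀ : ℝ × V3 × ℝ := (1, ū, totalEnergyDensity 1 ū Θ)
  have hθ₀ : 2 / 3 * (p₀.2.2 / p₀.1 - ‖p₀.2.1‖ ^ 2 / (2 * p₀.1 ^ 2)) = Θ := by
    have h := initL_theta_datum (a := (1 : ℝ)) (t := Θ) one_pos ū
    rw [one_smul] at h
    exact h
  have hmem : p₀ ∈ {p : ℝ × V3 × ℝ | 0 < p.1 ∧ p.1 * σ ^ 3 < η₀ ∧
      0 < 2 / 3 * (p.2.2 / p.1 - ‖p.2.1‖ ^ 2 / (2 * p.1 ^ 2))} := by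
    refine ⟨one_pos, show (1 : ℝ) * σ ^ 3 < η₀ by rwa [one_mul], ?_⟩
    rw [hθ₀]; exact hΘ
  have hHs : ContinuousAt (fun p : ℝ × V3 × ℝ => Hs σ p.1 (2 / 3 * (p.2.2 / p.1 - ‖p.2.1‖ ^ 2 / (2 * p.1 ^ 2)))) p₀ :=
    (initL_continuousOn_Hs hB hσ).continuousAt ((initL_isOpen_U η₀ σ).mem_nhds hmem)
  exact hHs.mul (continuous_cutRho.continuousAt.comp continuous_fst.continuousAt)

/-- The flux state maps are continuous at the constant state. -/
theorem continuousAt_GcutFlux {η₀ σ Θ : ℝ} {F : ℝ → ℝ} (hB : EosBand η₀ F) (hσ : 0 < σ) (hσ3 : σ ^ 3 < η₀)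
    (hΘ : 0 < Θ) (ū : V3) (k : Fin 3) : ContinuousAt (GcutFlux σ k) (1, ū, totalEnergyDensity 1 ū Θ) := by
  refine (continuousAt_Gcut hB hσ hσ3 hΘ ū).mul ?_
  refine ContinuousAt.div ?_ continuous_fst.continuousAt one_ne_zero
  exact ((continuous_apply k).comp (PiLp.continuous_ofLp 2 _ |>.comp continuous_snd.fst)).continuousAt

/-- Closeness of the three cone fields is closeness in the product metric of the state space. -/
theorem dist_state_lt {ρ e ρ₀ e₀ ι : ℝ} {m m₀ : V3} (h1 : |ρ - ρ₀| < ι) (h2 : ‖m - m₀‖ < ι) (h3 : |e - e₀| < ι) :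
    dist ((ρ, m, e) : ℝ × V3 × ℝ) (ρ₀, m₀, e₀) < ι := by
  rw [Prod.dist_eq, Prod.dist_eq, Real.dist_eq, Real.dist_eq, dist_eq_norm]
  exact max_lt h1 (max_lt h2 h3)

/-- **Registered stub E8b `eq_modulus`** of the equilibrium side-composition (line
`exact-entropy-ledger-three-passivities`): if the cone fields at `(w, x)` are `ι`-close to the constant state then the
static `L¹` integrand is below `ε`. -/
theorem eq_modulus :
  ∀ (η₀ : ℝ) (F : ℝ → ℝ), EosBand η₀ F → ∀ (σ Θ : ℝ) (ū : V3), 0 < σ → σ ^ 3 < η₀ → 0 < Θ →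
    ∀ ε : ℝ, 0 < ε → ∃ ι : ℝ, 0 < ι ∧ ∀ (N : ℕ) (r : ℝ) (w : Phase N) (x : T3),
      |rhoC r w x - 1| < ι → ‖momC r w x - ū‖ < ι → |kinC r w x - totalEnergyDensity 1 ū Θ| < ι →
      Ystat σ Θ ū r w x < ε := by
  intro η₀ F hB σ Θ ū hσ hσ3 hΘ ε hε
  set p₀ : ℝ × V3 × ℝ := (1, ū, totalEnergyDensity 1 ū Θ) with hp₀
  have hε8 : 0 < ε / 8 := by positivity
  obtain ⟨δ₀, hδ₀, H₀⟩ := Metric.continuousAt_iff.1 (continuousAt_Gcut hB hσ hσ3 hΘ ū) (ε / 8) hε8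
  have HF := fun k : Fin 3 => Metric.continuousAt_iff.1 (continuousAt_GcutFlux hB hσ hσ3 hΘ ū k) (ε / 8) hε8
  choose δk hδk Hk using HF
  refine ⟨min δ₀ (Finset.univ.inf' Finset.univ_nonempty δk), lt_min hδ₀ ?_, ?_⟩
  · exact (Finset.lt_inf'_iff _).2 fun k _ => hδk k
  intro N r w x h1 h2 h3
  set p : ℝ × V3 × ℝ := (rhoC r w x, momC r w x, kinC r w x) with hp
  have hd : dist p p₀ < min δ₀ (Finset.univ.inf' Finset.univ_nonempty δk) := dist_state_lt h1 h2 h3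
  have hd₀ : dist p p₀ < δ₀ := hd.trans_le (min_le_left _ _)
  have hdk : ∀ k, dist p p₀ < δk k := fun k =>
    hd.trans_le ((min_le_right _ _).trans (Finset.inf'_le _ (Finset.mem_univ k)))
  have hG : |HsT σ r w x - Hs σ 1 Θ| < ε / 8 := by
    rw [HsT_eq_Gcut, ← Gcut_const σ Θ ū, ← Real.dist_eq]
    exact H₀ hd₀
  have hGk : ∀ k : Fin 3, |HsT σ r w x * (momC r w x k / rhoC r w x) - Hs σ 1 Θ * ū k| < ε / 8 := by
    intro k
    have : HsT σ r w x * (momC r w x k / rhoC r w x) = GcutFlux σ k p := by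
      rw [HsT_eq_Gcut]; rfl
    rw [this, ← GcutFlux_const σ Θ ū k, ← Real.dist_eq]
    exact Hk k (hdk k)
  unfold Ystat
  have hsum : ∑ k : Fin 3, |HsT σ r w x * (momC r w x k / rhoC r w x) - Hs σ 1 Θ * ū k| ≤
      ∑ _k : Fin 3, ε / 8 := Finset.sum_le_sum fun k _ => (hGk k).le
  rw [Finset.sum_const, Finset.card_univ, Fintype.card_fin] at hsum
  simp only [nsmul_eq_mul, Nat.cast_ofNat] at hsum
  linarith
end Summit.AtomisticToContinuum.HydrodynamicLimit.Theorems.LocalSecondLawEquilibrium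

end
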